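import Literature.NumberTheory.EllipticCurves.SelmerFiniteProofs
import Literature.NumberTheory.EllipticCurves.KummerSelmerStructure
import Literature.NumberTheory.EllipticCurves.Jetchev2008.SelmerStructures
import HarnessLib

/-!
# The walk's input `hfin` DISCHARGED: the Selmer group of the Kummer structure made transverse at a
# finite set of places and relaxed at one place is FINITE, for every transverse family (cell
# `bsd-stepL`, seat `bsd-stepL-tam3-p1`, helper toward item 19109 `EulerHalvesAtThree`, registered
# stub `stub_jetchevMaxHLAtThree`)

HONEST FRAMING. Nothing here proves BSD, J₃ or any divisibility of a Heegner point; the registered stub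
is NOT discharged; no item closes; 0 classes move (T7); `--supports stmt-BirchSwinnertonDyer-19109`
(helper). WHAT THIS FILE DOES. The named input `hfin` of `Koly.tamagawaExponent_le_m_of_admissibleFamilies`
(p497855) ∕ of the supply displays (p498607, `…WalkSupplyAtThreeSharp`) — finiteness of
`((selmerF W n 𝒯 S).relaxedAt {v}).selmerGroup`, the relaxed Selmer modules `H_{𝓕^λ(c)}` of [J] §4.3
— is PROVED for every `n ≠ 0`, every transverse family `𝒯`, every finite set `S` of places and every
place `v`: such a Selmer group imposes the Kummer condition at every finite place outside
`S ∪ {v}`, hence (Silverman Cor. X.4.4 place by place: the tree's `selmerLocalKer_le_unramifiedKer`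
with the PROVED inertia compatibility `exists_mem_inertia_apply_eq_holds` and reduction step
`smul_localPoints_eq_of_mem_inertia_holds`, read through `comap_localization_kummerSelmerStructure`)
lies in `H¹(G_K, E[n]; T)` for the finite set `T = bad ∪ {w ∣ n} ∪ S ∪ {v}`, which is finite by
Silverman Lemma X.4.3 (the tree's PROVED `finite_h1Unramified_holds`). General statement
`finite_selmerGroup_transverseAt_relaxedAt` over any number field; `hfin_of_kummer` is the walk's
hypothesis verbatim (`W/ℚ` base-changed to `K`, `n = p^k`).
References (locators only; no cited FACT declared): [cite: SilvermanAEC2009, Lemma X.4.3, Cor. X.4.4]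
[cite: Jetchev2008, §4.3 (p. 816) (the structures 𝓕^λ(c))]. Design: theorems only; `K : Type u`
for the general statement, `K : Type` for the walk's form. Axioms: `propext`, `Classical.choice`,
`Quot.sound`.
-/

set_option autoImplicit false

noncomputable section

open scoped Classical NumberField

namespace Summit.BirchSwinnertonDyer.Rank1Residual.JET.Walk

open WeierstrassCurve IsDedekindDomain NumberField Literature.NumberTheory.EllipticCurves
  Literature.NumberTheory.EllipticCurves.Jetchev2008 Literature.NumberTheory.GaloisRepresentations
  Literature.NumberTheory.GaloisRepresentations.DiscreteGaloisModule

universe u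

/-- **Finiteness of the relaxed–transverse Kummer Selmer groups.** For an elliptic curve `X` over a
number field `K`, `n ≠ 0`, any family `𝒯` of local conditions, any finite set `S` of finite places
and any finite place `v`: the Selmer group of `(Kummer_n).transverseAt 𝒯 S` relaxed at `v` is finite
— it lies in `H¹(G_K, E[n]; bad ∪ {w ∣ n} ∪ S ∪ {v})` (Cor. X.4.4 place by place), finite by
Lemma X.4.3. [cite: SilvermanAEC2009, Lemma X.4.3, Cor. X.4.4] -/
theorem finite_selmerGroup_transverseAt_relaxedAt {K : Type u} [Field K] [NumberField K]
    (X : WeierstrassCurve K) [X.IsElliptic] {n : ℤ} (hn : n ≠ 0)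
    (𝒯 : SelmerStructure (X.torsionGaloisModule n)) (S : Finset (HeightOneSpectrum (𝓞 K)))
    (v : HeightOneSpectrum (𝓞 K)) :
    Finite (((X.kummerSelmerStructure n).transverseAt 𝒯 S).relaxedAt {v}).selmerGroup := by
  -- the finite set of exceptional places
  let T : Set (HeightOneSpectrum (𝓞 K)) :=
    (X.badPlaces (𝓞 K) ∪ {w | (n : 𝓞 K) ∈ w.asIdeal}) ∪ (↑S ∪ {v})
  have hT : T.Finite :=
    ((X.finite_badPlaces_holds (𝓞 K)).union
      (WeierstrassCurve.finite_setOf_intCast_mem_asIdeal (K := K) hn)).union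
      ((Finset.finite_toSet S).union (Set.finite_singleton v))
  -- the Selmer group lies in `H¹(G_K, E[n]; T)` (as a map of subtypes: the two ambient spellings of
  -- `H¹(K, E[n])` — `galoisCohomology (torsionGaloisModule n) 1` and `discreteH1 Γ_K E[n]` — agree by `rfl`)
  have hle : ∀ c : galoisCohomology (X.torsionGaloisModule n) 1,
      c ∈ (((X.kummerSelmerStructure n).transverseAt 𝒯 S).relaxedAt {v}).selmerGroup →
        (c : galH1Torsion X n) ∈ h1Unramified (geomTorsion X n) T := by
    intro c hc
    refine mem_h1Unramified_iff.mpr fun w hw 𝔓 h𝔓 ↦ ?_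
    simp only [T, Set.mem_union, Set.mem_setOf_eq, Set.mem_singleton_iff, Finset.mem_coe,
      not_or] at hw
    obtain ⟨⟨hbad, hwn⟩, hwS, hwv⟩ := hw
    -- the local condition at `w` is the Kummer condition
    have hwv' : w ∉ ({v} : Finset (HeightOneSpectrum (𝓞 K))) := by simpa using hwv
    have hcond : (((X.kummerSelmerStructure n).transverseAt 𝒯 S).relaxedAt {v}) (Sum.inr w) =
        X.kummerSelmerStructure n (Sum.inr w) := by
      simp [SelmerStructure.relaxedAt, SelmerStructure.transverseAt, hwv', hwS]
    have hloc : galoisCohomology.localization (X.torsionGaloisModule n) (Sum.inr w) 1 c ∈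
        X.kummerSelmerStructure n (Sum.inr w) := by
      have h := (SelmerStructure.mem_selmerGroup_iff
        (((X.kummerSelmerStructure n).transverseAt 𝒯 S).relaxedAt {v}) c).mp hc (Sum.inr w)
      rwa [hcond] at h
    have hker : (c : galH1Torsion X n) ∈ selmerLocalKer X (w.adicCompletion K) n :=
      (SetLike.ext_iff.mp (X.comap_localization_kummerSelmerStructure n (Sum.inr w)) c).mp
        (AddSubgroup.mem_comap.mpr hloc)
    exact selmerLocalKer_le_unramifiedKer
      (IsDedekindDomain.HeightOneSpectrum.exists_mem_inertia_apply_eq_holds w)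
      X.smul_localPoints_eq_of_mem_inertia_holds hbad hwn h𝔓 hker
  -- Lemma X.4.3
  haveI : Finite (geomTorsion X n) := X.finite_torsionPoints_holds (AlgebraicClosure K) hn
  haveI : ContinuousSMul (Field.absoluteGaloisGroup K) (geomTorsion X n) :=
    continuousSMul_geomTorsion X X.isOpen_stabilizer_point_holds n
  have hfin : Finite (h1Unramified (geomTorsion X n) T) := finite_h1Unramified_holds K _ hT
  refine @Finite.of_injective _ _ hfin
    (fun x ↦ (⟨(x.1 : galH1Torsion X n), hle x.1 x.2⟩ : h1Unramified (geomTorsion X n) T)) ?_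
  intro a b h
  exact Subtype.ext (congrArg Subtype.val h :)

/-- **The walk's `hfin`, VERBATIM** (`Koly.tamagawaExponent_le_m_of_admissibleFamilies`, p497855):
`Finite ((selmerF W p^k 𝒯 (placesDividing K m)).relaxedAt {v}).selmerGroup` for every `m` and `v`.
[cite: SilvermanAEC2009, Lemma X.4.3, Cor. X.4.4] [cite: Jetchev2008, §4.3 (p. 816)] -/
theorem hfin_of_kummer {K : Type} [Field K] [NumberField K] (W : WeierstrassCurve ℚ) [W.IsElliptic]
    {p : ℕ} (hp : p.Prime) (k : ℕ)
    (𝒯 : SelmerStructure ((W.baseChange K).torsionGaloisModule ((p ^ k : ℕ) : ℤ))) :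
    ∀ (m : ℕ) (v : HeightOneSpectrum (𝓞 K)),
      Finite ((selmerF W ((p ^ k : ℕ) : ℤ) 𝒯 (placesDividing K m)).relaxedAt {v}).selmerGroup := by
  intro m v
  haveI : (W.baseChange K).IsElliptic := inferInstanceAs (W.map (algebraMap ℚ K)).IsElliptic
  exact finite_selmerGroup_transverseAt_relaxedAt (W.baseChange K)
    (by exact_mod_cast pow_ne_zero k hp.ne_zero) 𝒯 (placesDividing K m) v

end Summit.BirchSwinnertonDyer.Rank1Residual.JET.Walk

end
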